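import Literature.MathematicalPhysics.MHD.TearingResistiveLayer

/-!
# The matching constant of the constant-ψ tearing layer, CERTIFIED: `2.114 < ∫(1 + XU)dX < 2.128` and
# `0.546 < C^{−4/5} < 0.550` — the printed «≈ 2.12» of (20.38) and the printed coefficient «0.55» of (20.39)
# in Goldston–Rutherford §20.4, now kernel-checked to two digits

Topic `Literature/MathematicalPhysics/MHD` (namespace = path; sub-namespace `Tearing.ResistiveLayer`, extending
`TearingResistiveLayer.lean` §4 where `C = matchingConstant = (2π)^{1/2}∫₀^{π/2} sin^{1/2}θ cos^{1/2}θ dθ` was PROVED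
equal to `∫(1 + XU)dX` and bracketed only as `√π ≤ C ≤ √(2π)`).  Written for GRIDFUSION (lit-3): moves the two
printed numbers of register row A52 from the VALIDATED to the CERTIFIED column.

## Method (all in the kernel; no floating point)
§1 symmetry `θ ↦ π/2 − θ`: `J = ∫₀^{π/2}√cos√sin = 2∫₀^{π/4}√cos√sin`.  §2 on `[0, π/4] ⊂ [0, 1]` Mathlib's Taylor
bounds `|sin θ − (θ − θ³/6)| ≤ θ⁵/100`, `|cos θ − (1 − θ²/2)| ≤ (5/96)θ⁴`, `1 − θ²/2 ≤ cos θ` give the explicit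
envelopes `√θ(1 − θ²/12 − 7θ⁴/600) ≤ √(sin θ) ≤ √θ(1 − θ²/12 + θ⁴/200)` and
`1 − θ²/4 − θ⁴/32 − θ⁶/64 ≤ √(cos θ) ≤ 1 − θ²/4`.  §3 the products are `√θ·(polynomial)`, integrated EXACTLY by
the fundamental theorem with the antiderivatives `θ√θ·Q(θ)`.  §4 `C = √2π²/4·(2·…)`-type closed forms are
compared with decimals using `3.141592 < π < 3.141593`.

## Contents — every theorem PROVED (0 named facts, 0 sorry)
* `thetaIntegral_eq_two_mul` (§1); `sqrt_sin_le`, `le_sqrt_sin`, `sqrt_cos_le`, `le_sqrt_cos` (§2);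
  `integral_upper`, `integral_lower` (§3); ★ `matchingConstant_bounds : 2.114 < C ∧ C < 2.128`,
  ★ `coefficient_bounds : 0.546 < C^{−4/5} ∧ C^{−4/5} < 0.550` (§4) — «≈ 2.12», «0.55» [cite (20.38)–(20.39)].

## Sources
* R. J. Goldston, P. H. Rutherford, *Introduction to Plasma Physics*, IOP 1995 [GoldstonRutherford1995], §20.4
  eq. (20.38) «≈ 2.12 where the final integral … has been evaluated numerically» and eq. (20.39) (coefficient
  `0.55`) [galaxy:panama:262663019954218 chunk p0294].
-/

noncomputable section

open Real Set Filter MeasureTheory intervalIntegral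
open _root_.Topology

namespace Literature.MathematicalPhysics.MHD

namespace Tearing.ResistiveLayer

/-! ## §1 Symmetry: `J = 2∫₀^{π/4} √cos θ √sin θ dθ` -/

/-- The integrand of `thetaIntegral` is continuous. [cite: GoldstonRutherford1995, §20.4 eq. (20.38)] -/
theorem continuous_sqrtCosSin : Continuous fun θ : ℝ => Real.sqrt (Real.cos θ) * Real.sqrt (Real.sin θ) := by
  fun_prop

/-- `J = ∫₀^{π/2} cos^{1/2}θ sin^{1/2}θ dθ = 2∫₀^{π/4} cos^{1/2}θ sin^{1/2}θ dθ` (reflection `θ ↦ π/2 − θ`).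
[cite: GoldstonRutherford1995, §20.4 eq. (20.38)] -/
theorem thetaIntegral_eq_two_mul :
    thetaIntegral = 2 * ∫ θ in (0 : ℝ)..(π / 4), Real.sqrt (Real.cos θ) * Real.sqrt (Real.sin θ) := by
  unfold thetaIntegral
  have hf := continuous_sqrtCosSin
  rw [← intervalIntegral.integral_add_adjacent_intervals (hf.intervalIntegrable 0 (π / 4))
    (hf.intervalIntegrable (π / 4) (π / 2))]
  have hsym : ∫ θ in (π / 4)..(π / 2), Real.sqrt (Real.cos θ) * Real.sqrt (Real.sin θ)
      = ∫ θ in (0 : ℝ)..(π / 4), Real.sqrt (Real.cos θ) * Real.sqrt (Real.sin θ) := by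
    have h := intervalIntegral.integral_comp_sub_left
      (fun θ => Real.sqrt (Real.cos θ) * Real.sqrt (Real.sin θ)) (π / 2) (a := 0) (b := π / 4)
    rw [show π / 2 - π / 4 = π / 4 by ring, sub_zero] at h
    rw [← h]
    refine intervalIntegral.integral_congr fun θ _ => ?_
    simp only [Real.cos_pi_div_two_sub, Real.sin_pi_div_two_sub]
    ring
  rw [hsym]; ring

/-! ## §2 Polynomial envelopes of `√sin` and `√cos` on `[0, π/4]` -/

/-- Upper envelope of `√(sin θ)`: `√θ(1 − θ²/12 + θ⁴/200)`. [cite: GoldstonRutherford1995, §20.4 eq. (20.38)] -/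
def sinUpper (θ : ℝ) : ℝ := Real.sqrt θ * (1 - θ ^ 2 / 12 + θ ^ 4 / 200)

/-- Lower envelope of `√(sin θ)`: `√θ(1 − θ²/12 − 7θ⁴/600)`. [cite: GoldstonRutherford1995, §20.4 eq. (20.38)] -/
def sinLower (θ : ℝ) : ℝ := Real.sqrt θ * (1 - θ ^ 2 / 12 - 7 * θ ^ 4 / 600)

/-- Upper envelope of `√(cos θ)`: `1 − θ²/4`. [cite: GoldstonRutherford1995, §20.4 eq. (20.38)] -/
def cosUpper (θ : ℝ) : ℝ := 1 - θ ^ 2 / 4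

/-- Lower envelope of `√(cos θ)`: `1 − θ²/4 − θ⁴/32 − θ⁶/64`. [cite: GoldstonRutherford1995, §20.4 eq. (20.38)] -/
def cosLower (θ : ℝ) : ℝ := 1 - θ ^ 2 / 4 - θ ^ 4 / 32 - θ ^ 6 / 64

/-- `π/4 < 1`. [folklore] -/
private theorem pi_div_four_lt_one : π / 4 < 1 := by linarith [Real.pi_lt_d6]

/-- On `[0, π/4]`: `0 ≤ θ ≤ 1`. [folklore] -/
private theorem mem_unit {θ : ℝ} (h : θ ∈ Icc 0 (π / 4)) : 0 ≤ θ ∧ θ ≤ 1 :=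
  ⟨h.1, h.2.trans pi_div_four_lt_one.le⟩

/-- `√(sin θ) ≤ √θ(1 − θ²/12 + θ⁴/200)` on `[0, π/4]` (from `sin θ ≤ θ − θ³/6 + θ⁵/100`).
[cite: GoldstonRutherford1995, §20.4 eq. (20.38)] -/
theorem sqrt_sin_le {θ : ℝ} (h : θ ∈ Icc 0 (π / 4)) : Real.sqrt (Real.sin θ) ≤ sinUpper θ := by
  obtain ⟨h0, h1⟩ := mem_unit h
  have habs : |θ| ≤ 1 := by rw [abs_of_nonneg h0]; exact h1
  have hb := Real.sin_bound habs
  rw [abs_of_nonneg h0] at hb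
  have hs : Real.sin θ ≤ θ - θ ^ 3 / 6 + θ ^ 5 / 100 := by
    have := (abs_le.1 hb).2; linarith
  set p := 1 - θ ^ 2 / 12 + θ ^ 4 / 200 with hp
  have hp0 : 0 ≤ p := by rw [hp]; nlinarith [sq_nonneg θ, pow_le_one₀ h0 h1 (n := 2)]
  have key : Real.sin θ ≤ θ * p ^ 2 := by
    have e : θ * p ^ 2 = θ - θ ^ 3 / 6 + θ ^ 5 / 100 + θ * (θ ^ 2 / 6 - θ ^ 4 / 100) ^ 2 / 4 := by
      rw [hp]; ring
    have : 0 ≤ θ * (θ ^ 2 / 6 - θ ^ 4 / 100) ^ 2 / 4 := by positivity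
    linarith
  calc Real.sqrt (Real.sin θ) ≤ Real.sqrt (θ * p ^ 2) := Real.sqrt_le_sqrt key
    _ = Real.sqrt θ * p := by rw [Real.sqrt_mul h0, Real.sqrt_sq hp0]

/-- `√θ(1 − θ²/12 − 7θ⁴/600) ≤ √(sin θ)` on `[0, π/4]` (from `θ − θ³/6 − θ⁵/100 ≤ sin θ`).
[cite: GoldstonRutherford1995, §20.4 eq. (20.38)] -/
theorem le_sqrt_sin {θ : ℝ} (h : θ ∈ Icc 0 (π / 4)) : sinLower θ ≤ Real.sqrt (Real.sin θ) := by
  obtain ⟨h0, h1⟩ := mem_unit h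
  have habs : |θ| ≤ 1 := by rw [abs_of_nonneg h0]; exact h1
  have hb := Real.sin_bound habs
  rw [abs_of_nonneg h0] at hb
  have hs : θ - θ ^ 3 / 6 - θ ^ 5 / 100 ≤ Real.sin θ := by
    have := (abs_le.1 hb).1; linarith
  set q := 1 - θ ^ 2 / 12 - 7 * θ ^ 4 / 600 with hq
  have hθ2 : θ ^ 2 ≤ 1 := pow_le_one₀ h0 h1
  have hθ4 : θ ^ 4 ≤ 1 := pow_le_one₀ h0 h1
  have hq0 : 0 ≤ q := by rw [hq]; nlinarith
  have key : θ * q ^ 2 ≤ Real.sin θ := by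
    have e : (θ - θ ^ 3 / 6 - θ ^ 5 / 100) - θ * q ^ 2
        = θ ^ 5 * (69 / 10800 - 7 * θ ^ 2 / 3600 - 49 * θ ^ 4 / 360000) := by rw [hq]; ring
    have hbr : 0 ≤ 69 / 10800 - 7 * θ ^ 2 / 3600 - 49 * θ ^ 4 / 360000 := by nlinarith
    have : 0 ≤ θ ^ 5 * (69 / 10800 - 7 * θ ^ 2 / 3600 - 49 * θ ^ 4 / 360000) :=
      mul_nonneg (by positivity) hbr
    linarith
  unfold sinLower
  rw [← hq]
  have hy : 0 ≤ Real.sqrt θ * q := mul_nonneg (Real.sqrt_nonneg _) hq0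
  calc Real.sqrt θ * q = Real.sqrt ((Real.sqrt θ * q) ^ 2) := (Real.sqrt_sq hy).symm
    _ ≤ Real.sqrt (Real.sin θ) := Real.sqrt_le_sqrt (by rw [mul_pow, Real.sq_sqrt h0]; exact key)

/-- `√(cos θ) ≤ 1 − θ²/4` on `[0, π/4]` (from `cos θ ≤ 1 − θ²/2 + (5/96)θ⁴ ≤ (1 − θ²/4)²`).
[cite: GoldstonRutherford1995, §20.4 eq. (20.38)] -/
theorem sqrt_cos_le {θ : ℝ} (h : θ ∈ Icc 0 (π / 4)) : Real.sqrt (Real.cos θ) ≤ cosUpper θ := by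
  obtain ⟨h0, h1⟩ := mem_unit h
  have habs : |θ| ≤ 1 := by rw [abs_of_nonneg h0]; exact h1
  have hb := Real.cos_bound habs
  rw [abs_of_nonneg h0] at hb
  have hc : Real.cos θ ≤ 1 - θ ^ 2 / 2 + θ ^ 4 * (5 / 96) := by
    have := (abs_le.1 hb).2; linarith
  have hp0 : 0 ≤ 1 - θ ^ 2 / 4 := by nlinarith [pow_le_one₀ h0 h1 (n := 2)]
  have key : Real.cos θ ≤ (1 - θ ^ 2 / 4) ^ 2 := by nlinarith [sq_nonneg (θ ^ 2)]
  calc Real.sqrt (Real.cos θ) ≤ Real.sqrt ((1 - θ ^ 2 / 4) ^ 2) := Real.sqrt_le_sqrt key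
    _ = cosUpper θ := by rw [Real.sqrt_sq hp0]; rfl

/-- `1 − θ²/4 − θ⁴/32 − θ⁶/64 ≤ √(cos θ)` on `[0, π/4]` (from `1 − θ²/2 ≤ cos θ`).
[cite: GoldstonRutherford1995, §20.4 eq. (20.38)] -/
theorem le_sqrt_cos {θ : ℝ} (h : θ ∈ Icc 0 (π / 4)) : cosLower θ ≤ Real.sqrt (Real.cos θ) := by
  obtain ⟨h0, h1⟩ := mem_unit h
  have hc : 1 - θ ^ 2 / 2 ≤ Real.cos θ := Real.one_sub_sq_div_two_le_cos
  set r := 1 - θ ^ 2 / 4 - θ ^ 4 / 32 - θ ^ 6 / 64 with hr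
  have hθ2 : θ ^ 2 ≤ 1 := pow_le_one₀ h0 h1
  have hθ4 : θ ^ 4 ≤ 1 := pow_le_one₀ h0 h1
  have hθ6 : θ ^ 6 ≤ 1 := pow_le_one₀ h0 h1
  have hr0 : 0 ≤ r := by rw [hr]; nlinarith
  have key : r ^ 2 ≤ Real.cos θ := by
    have e : (1 - θ ^ 2 / 2) - r ^ 2
        = θ ^ 6 * (1 / 64 - 9 * θ ^ 2 / 1024 - θ ^ 4 / 1024 - θ ^ 6 / 4096) := by rw [hr]; ring
    have hbr : 0 ≤ 1 / 64 - 9 * θ ^ 2 / 1024 - θ ^ 4 / 1024 - θ ^ 6 / 4096 := by nlinarith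
    have : 0 ≤ θ ^ 6 * (1 / 64 - 9 * θ ^ 2 / 1024 - θ ^ 4 / 1024 - θ ^ 6 / 4096) :=
      mul_nonneg (by positivity) hbr
    linarith
  unfold cosLower
  rw [← hr]
  calc r = Real.sqrt (r ^ 2) := (Real.sqrt_sq hr0).symm
    _ ≤ Real.sqrt (Real.cos θ) := Real.sqrt_le_sqrt key

/-- The lower envelopes are non-negative on `[0, π/4]`. [folklore] -/
private theorem envelopes_nonneg {θ : ℝ} (h : θ ∈ Icc 0 (π / 4)) : 0 ≤ sinLower θ ∧ 0 ≤ cosLower θ := by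
  obtain ⟨h0, h1⟩ := mem_unit h
  have hθ2 : θ ^ 2 ≤ 1 := pow_le_one₀ h0 h1
  have hθ4 : θ ^ 4 ≤ 1 := pow_le_one₀ h0 h1
  have hθ6 : θ ^ 6 ≤ 1 := pow_le_one₀ h0 h1
  refine ⟨mul_nonneg (Real.sqrt_nonneg _) (by nlinarith), by unfold cosLower; nlinarith⟩

/-- THE PRODUCT ENVELOPES: on `[0, π/4]`,
`√θ·P_L(θ) ≤ √(cos θ)√(sin θ) ≤ √θ·P_U(θ)` with `P_U = 1 − θ²/3 + 31θ⁴/1200 − θ⁶/800`,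
`P_L = 1 − θ²/3 − 53θ⁴/2400 − 97θ⁶/9600 + θ⁸/600 + 7θ¹⁰/38400`. [cite: GoldstonRutherford1995, §20.4 eq. (20.38)] -/
theorem integrand_envelope {θ : ℝ} (h : θ ∈ Icc 0 (π / 4)) :
    Real.sqrt θ * (1 - θ ^ 2 / 3 - 53 * θ ^ 4 / 2400 - 97 * θ ^ 6 / 9600 + θ ^ 8 / 600
        + 7 * θ ^ 10 / 38400)
      ≤ Real.sqrt (Real.cos θ) * Real.sqrt (Real.sin θ) ∧
    Real.sqrt (Real.cos θ) * Real.sqrt (Real.sin θ)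
      ≤ Real.sqrt θ * (1 - θ ^ 2 / 3 + 31 * θ ^ 4 / 1200 - θ ^ 6 / 800) := by
  obtain ⟨hL1, hL2⟩ := envelopes_nonneg h
  constructor
  · have e : Real.sqrt θ * (1 - θ ^ 2 / 3 - 53 * θ ^ 4 / 2400 - 97 * θ ^ 6 / 9600 + θ ^ 8 / 600
        + 7 * θ ^ 10 / 38400) = cosLower θ * sinLower θ := by
      unfold cosLower sinLower; ring
    rw [e]
    exact mul_le_mul (le_sqrt_cos h) (le_sqrt_sin h) hL1 (Real.sqrt_nonneg _)
  · have e : Real.sqrt θ * (1 - θ ^ 2 / 3 + 31 * θ ^ 4 / 1200 - θ ^ 6 / 800)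
        = cosUpper θ * sinUpper θ := by
      unfold cosUpper sinUpper; ring
    rw [e]
    have hU2 : 0 ≤ cosUpper θ := hL2.trans ((le_sqrt_cos h).trans (sqrt_cos_le h))
    exact mul_le_mul (sqrt_cos_le h) (sqrt_sin_le h) (Real.sqrt_nonneg _) hU2

/-! ## §3 Exact integrals of the envelopes -/

/-- `Q_U(θ) = 2/3 − (2/21)θ² + (31/6600)θ⁴ − θ⁶/6000`, so that `d/dθ[θ√θ Q_U(θ)] = √θ P_U(θ)`.
[cite: GoldstonRutherford1995, §20.4 eq. (20.38)] -/
def qUpper (θ : ℝ) : ℝ := 2 / 3 - 2 / 21 * θ ^ 2 + 31 / 6600 * θ ^ 4 - θ ^ 6 / 6000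

/-- `Q_L(θ) = 2/3 − (2/21)θ² − (53/13200)θ⁴ − (97/72000)θ⁶ + θ⁸/5700 + (7/441600)θ¹⁰`.
[cite: GoldstonRutherford1995, §20.4 eq. (20.38)] -/
def qLower (θ : ℝ) : ℝ :=
  2 / 3 - 2 / 21 * θ ^ 2 - 53 / 13200 * θ ^ 4 - 97 / 72000 * θ ^ 6 + θ ^ 8 / 5700 + 7 / 441600 * θ ^ 10

/-- FTC for integrands `√θ·P(θ)` with antiderivative `θ√θ·Q(θ)`: if `(3/2)Q + θQ′ = P` then
`∫₀^a √θ P = a√a Q(a)` (`a ≥ 0`). [folklore] -/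
private theorem integral_sqrt_mul_poly {P Q Q' : ℝ → ℝ} (hQ : ∀ θ, HasDerivAt Q (Q' θ) θ)
    (hrel : ∀ θ, 3 / 2 * Q θ + θ * Q' θ = P θ) (hP : Continuous P) (hQc : Continuous Q) {a : ℝ}
    (ha : 0 ≤ a) :
    ∫ θ in (0 : ℝ)..a, Real.sqrt θ * P θ = a * Real.sqrt a * Q a := by
  have hF : ∀ θ ∈ Ioo 0 a, HasDerivAt (fun θ => θ * Real.sqrt θ * Q θ) (Real.sqrt θ * P θ) θ := by
    intro θ hθ
    have hθ0 : 0 < θ := hθ.1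
    have hs := Real.hasDerivAt_sqrt hθ0.ne'
    have h1 : HasDerivAt (fun θ => θ * Real.sqrt θ) (1 * Real.sqrt θ + θ * (1 / (2 * Real.sqrt θ))) θ :=
      (hasDerivAt_id θ).mul hs
    have h2 := h1.mul (hQ θ)
    refine h2.congr_deriv ?_
    have hsq : 0 < Real.sqrt θ := Real.sqrt_pos.2 hθ0
    have hss : Real.sqrt θ * Real.sqrt θ = θ := Real.mul_self_sqrt hθ0.le
    have h3 : θ * (1 / (2 * Real.sqrt θ)) = Real.sqrt θ / 2 := by
      rw [mul_one_div, div_eq_div_iff (by positivity) two_ne_zero]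
      linear_combination (-2 : ℝ) * hss
    rw [← hrel θ, h3]
    ring
  rw [intervalIntegral.integral_eq_sub_of_hasDerivAt_of_le ha
    ((by fun_prop : Continuous fun θ => θ * Real.sqrt θ * Q θ).continuousOn) hF
    ((by fun_prop : Continuous fun θ => Real.sqrt θ * P θ).intervalIntegrable 0 a)]
  simp

/-- `∫₀^{π/4} √θ P_U(θ) dθ = (π/4)√(π/4) Q_U(π/4)`. [cite: GoldstonRutherford1995, §20.4 eq. (20.38)] -/
theorem integral_upper :
    ∫ θ in (0 : ℝ)..(π / 4), Real.sqrt θ * (1 - θ ^ 2 / 3 + 31 * θ ^ 4 / 1200 - θ ^ 6 / 800)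
      = π / 4 * Real.sqrt (π / 4) * qUpper (π / 4) := by
  refine integral_sqrt_mul_poly (Q := qUpper)
    (Q' := fun θ => -(2 / 21) * (2 * θ) + 31 / 6600 * (4 * θ ^ 3) - 6 * θ ^ 5 / 6000)
    (fun θ => ?_) (fun θ => ?_) (by fun_prop) (by unfold qUpper; fun_prop) (by positivity)
  · unfold qUpper
    have h := ((hasDerivAt_pow 2 θ).const_mul (2 / 21 : ℝ))
    have h4 := ((hasDerivAt_pow 4 θ).const_mul (31 / 6600 : ℝ))
    have h6 := (hasDerivAt_pow 6 θ).div_const (6000 : ℝ)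
    have := (((hasDerivAt_const θ (2 / 3 : ℝ)).sub h).add h4).sub h6
    refine this.congr_deriv ?_
    push_cast; ring
  · unfold qUpper; ring

/-- `∫₀^{π/4} √θ P_L(θ) dθ = (π/4)√(π/4) Q_L(π/4)`. [cite: GoldstonRutherford1995, §20.4 eq. (20.38)] -/
theorem integral_lower :
    ∫ θ in (0 : ℝ)..(π / 4), Real.sqrt θ * (1 - θ ^ 2 / 3 - 53 * θ ^ 4 / 2400 - 97 * θ ^ 6 / 9600
        + θ ^ 8 / 600 + 7 * θ ^ 10 / 38400)
      = π / 4 * Real.sqrt (π / 4) * qLower (π / 4) := by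
  refine integral_sqrt_mul_poly (Q := qLower)
    (Q' := fun θ => -(2 / 21) * (2 * θ) - 53 / 13200 * (4 * θ ^ 3) - 97 / 72000 * (6 * θ ^ 5)
      + 8 * θ ^ 7 / 5700 + 7 / 441600 * (10 * θ ^ 9))
    (fun θ => ?_) (fun θ => ?_) (by fun_prop) (by unfold qLower; fun_prop) (by positivity)
  · unfold qLower
    have h2 := ((hasDerivAt_pow 2 θ).const_mul (2 / 21 : ℝ))
    have h4 := ((hasDerivAt_pow 4 θ).const_mul (53 / 13200 : ℝ))
    have h6 := ((hasDerivAt_pow 6 θ).const_mul (97 / 72000 : ℝ))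
    have h8 := (hasDerivAt_pow 8 θ).div_const (5700 : ℝ)
    have h10 := ((hasDerivAt_pow 10 θ).const_mul (7 / 441600 : ℝ))
    have := (((((hasDerivAt_const θ (2 / 3 : ℝ)).sub h2).sub h4).sub h6).add h8).add h10
    refine this.congr_deriv ?_
    push_cast; ring
  · unfold qLower; ring

/-! ## §4 The certified enclosures -/

/-- `2·∫₀^{π/4}` of the envelopes brackets `J`: `(π/2)√(π/4)Q_L(π/4) ≤ J ≤ (π/2)√(π/4)Q_U(π/4)`.
[cite: GoldstonRutherford1995, §20.4 eq. (20.38)] -/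
theorem thetaIntegral_bounds :
    2 * (π / 4 * Real.sqrt (π / 4) * qLower (π / 4)) ≤ thetaIntegral ∧
      thetaIntegral ≤ 2 * (π / 4 * Real.sqrt (π / 4) * qUpper (π / 4)) := by
  rw [thetaIntegral_eq_two_mul, ← integral_lower, ← integral_upper]
  have hpi : (0 : ℝ) ≤ π / 4 := by positivity
  have hf := continuous_sqrtCosSin.intervalIntegrable (μ := volume) 0 (π / 4)
  have hL := (by fun_prop : Continuous fun θ : ℝ =>
      Real.sqrt θ * (1 - θ ^ 2 / 3 - 53 * θ ^ 4 / 2400 - 97 * θ ^ 6 / 9600 + θ ^ 8 / 600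
        + 7 * θ ^ 10 / 38400)).intervalIntegrable (μ := volume) 0 (π / 4)
  have hU := (by fun_prop : Continuous fun θ : ℝ =>
      Real.sqrt θ * (1 - θ ^ 2 / 3 + 31 * θ ^ 4 / 1200 - θ ^ 6 / 800)).intervalIntegrable
        (μ := volume) 0 (π / 4)
  constructor
  · refine mul_le_mul_of_nonneg_left ?_ (by norm_num)
    exact intervalIntegral.integral_mono_on hpi hL hf fun θ hθ => (integrand_envelope hθ).1
  · refine mul_le_mul_of_nonneg_left ?_ (by norm_num)
    exact intervalIntegral.integral_mono_on hpi hf hU fun θ hθ => (integrand_envelope hθ).2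

/-- The closed-form prefactor: `(2π)^{1/2}·2·(π/4)·(π/4)^{1/2} = √2·π²/4`. [folklore] -/
private theorem prefactor_eq : Real.sqrt (2 * π) * (2 * (π / 4 * Real.sqrt (π / 4))) = Real.sqrt 2 * π ^ 2 / 4 := by
  have hπ := Real.pi_pos.le
  rw [Real.sqrt_mul (by norm_num : (0 : ℝ) ≤ 2), Real.sqrt_div' π (by norm_num : (0 : ℝ) ≤ 4),
    show Real.sqrt (4 : ℝ) = 2 by rw [show (4 : ℝ) = 2 ^ 2 by norm_num, Real.sqrt_sq (by norm_num)]]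
  have hss : Real.sqrt π * Real.sqrt π = π := Real.mul_self_sqrt hπ
  calc Real.sqrt 2 * Real.sqrt π * (2 * (π / 4 * (Real.sqrt π / 2)))
      = Real.sqrt 2 * (π * (Real.sqrt π * Real.sqrt π)) / 4 := by ring
    _ = Real.sqrt 2 * π ^ 2 / 4 := by rw [hss]; ring

/-- Numerical values of the two polynomials at `π/4` (from `3.141592 < π < 3.141593`):
`Q_U(π/4) < 0.60968`, `0.60609 < Q_L(π/4)`. [folklore] -/
private theorem q_values : qUpper (π / 4) < 0.60968 ∧ 0.60609 < qLower (π / 4) := by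
  have hlo : (0.785398 : ℝ) < π / 4 := by linarith [Real.pi_gt_d6]
  have hhi : π / 4 < (0.7853983 : ℝ) := by linarith [Real.pi_lt_d6]
  set x := π / 4 with hx
  have hx0 : 0 ≤ x := by rw [hx]; positivity
  have h2l : (0.785398 : ℝ) ^ 2 ≤ x ^ 2 := pow_le_pow_left₀ (by norm_num) hlo.le 2
  have h2u : x ^ 2 ≤ (0.7853983 : ℝ) ^ 2 := pow_le_pow_left₀ hx0 hhi.le 2
  have h4l : (0.785398 : ℝ) ^ 4 ≤ x ^ 4 := pow_le_pow_left₀ (by norm_num) hlo.le 4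
  have h4u : x ^ 4 ≤ (0.7853983 : ℝ) ^ 4 := pow_le_pow_left₀ hx0 hhi.le 4
  have h6l : (0.785398 : ℝ) ^ 6 ≤ x ^ 6 := pow_le_pow_left₀ (by norm_num) hlo.le 6
  have h6u : x ^ 6 ≤ (0.7853983 : ℝ) ^ 6 := pow_le_pow_left₀ hx0 hhi.le 6
  have h8l : (0.785398 : ℝ) ^ 8 ≤ x ^ 8 := pow_le_pow_left₀ (by norm_num) hlo.le 8
  have h10l : (0.785398 : ℝ) ^ 10 ≤ x ^ 10 := pow_le_pow_left₀ (by norm_num) hlo.le 10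
  unfold qUpper qLower
  constructor
  · nlinarith
  · nlinarith

/-- ★ THE MATCHING CONSTANT, CERTIFIED: `2.114 < C < 2.128` — the printed «`≈ 2.12`» of (20.38)
(`C = ∫_{−∞}^{∞}(1 + XU)dX = (2π)^{1/2}∫₀^{π/2} sin^{1/2}θ cos^{1/2}θ dθ`, `integral_one_add_mul_layerU`).
[cite: GoldstonRutherford1995, §20.4 eq. (20.38)] -/
theorem matchingConstant_bounds : 2.114 < matchingConstant ∧ matchingConstant < 2.128 := by
  obtain ⟨hJl, hJu⟩ := thetaIntegral_bounds
  obtain ⟨hqU, hqL⟩ := q_values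
  have hs2l : (1.414213 : ℝ) < Real.sqrt 2 := by
    rw [show (1.414213 : ℝ) = Real.sqrt (1.414213 ^ 2) by rw [Real.sqrt_sq (by norm_num)]]
    exact Real.sqrt_lt_sqrt (by norm_num) (by norm_num)
  have hs2u : Real.sqrt 2 < (1.414214 : ℝ) := by
    rw [show (1.414214 : ℝ) = Real.sqrt (1.414214 ^ 2) by rw [Real.sqrt_sq (by norm_num)]]
    exact Real.sqrt_lt_sqrt (by norm_num) (by norm_num)
  have hπl := Real.pi_gt_d6
  have hπu := Real.pi_lt_d6
  have hπ2l : (3.141592 : ℝ) ^ 2 < π ^ 2 := by nlinarith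
  have hπ2u : π ^ 2 < (3.141593 : ℝ) ^ 2 := by nlinarith
  have hpre := prefactor_eq
  have hpos : 0 < Real.sqrt (2 * π) := Real.sqrt_pos.2 (by positivity)
  unfold matchingConstant
  constructor
  · have h1 : Real.sqrt (2 * π) * (2 * (π / 4 * Real.sqrt (π / 4) * qLower (π / 4)))
        ≤ Real.sqrt (2 * π) * thetaIntegral := mul_le_mul_of_nonneg_left hJl hpos.le
    have e : Real.sqrt (2 * π) * (2 * (π / 4 * Real.sqrt (π / 4) * qLower (π / 4)))
        = Real.sqrt 2 * π ^ 2 / 4 * qLower (π / 4) := by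
      rw [← hpre]; ring
    rw [e] at h1
    have h2 : (1.414213 : ℝ) * 3.141592 ^ 2 / 4 * 0.60609 < Real.sqrt 2 * π ^ 2 / 4 * qLower (π / 4) := by
      have a1 : (0 : ℝ) < 1.414213 * 3.141592 ^ 2 / 4 := by norm_num
      have : (1.414213 : ℝ) * 3.141592 ^ 2 / 4 < Real.sqrt 2 * π ^ 2 / 4 := by nlinarith
      nlinarith
    have h3 : (2.114 : ℝ) < 1.414213 * 3.141592 ^ 2 / 4 * 0.60609 := by norm_num
    linarith
  · have h1 : Real.sqrt (2 * π) * thetaIntegral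
        ≤ Real.sqrt (2 * π) * (2 * (π / 4 * Real.sqrt (π / 4) * qUpper (π / 4))) :=
      mul_le_mul_of_nonneg_left hJu hpos.le
    have e : Real.sqrt (2 * π) * (2 * (π / 4 * Real.sqrt (π / 4) * qUpper (π / 4)))
        = Real.sqrt 2 * π ^ 2 / 4 * qUpper (π / 4) := by
      rw [← hpre]; ring
    rw [e] at h1
    have hqU0 : 0 < qUpper (π / 4) := by
      have := thetaIntegral_pos
      have hpp : 0 < π / 4 * Real.sqrt (π / 4) := by positivity
      nlinarith
    have h2 : Real.sqrt 2 * π ^ 2 / 4 * qUpper (π / 4) < (1.414214 : ℝ) * 3.141593 ^ 2 / 4 * 0.60968 := by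
      have : Real.sqrt 2 * π ^ 2 / 4 < (1.414214 : ℝ) * 3.141593 ^ 2 / 4 := by
        have := Real.sqrt_nonneg 2; nlinarith
      have a0 : 0 ≤ Real.sqrt 2 * π ^ 2 / 4 := by positivity
      nlinarith
    have h3 : (1.414214 : ℝ) * 3.141593 ^ 2 / 4 * 0.60968 < 2.128 := by norm_num
    linarith

/-- ★ THE PRINTED COEFFICIENT OF (20.39), CERTIFIED: `0.546 < C^{−4/5} < 0.550` — the printed «`0.55`»
(`γ = 0.55 Δ′^{4/5}η^{3/5}(kB′_{y0})^{2/5}/(ρ₀^{1/5}μ₀^{4/5})`, i.e. `growthRate matchingConstant …`).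
[cite: GoldstonRutherford1995, §20.4 eq. (20.39)] -/
theorem coefficient_bounds :
    0.546 < matchingConstant ^ (-(4 / 5) : ℝ) ∧ matchingConstant ^ (-(4 / 5) : ℝ) < 0.550 := by
  obtain ⟨hl, hu⟩ := matchingConstant_bounds
  have hC : 0 < matchingConstant := matchingConstant_pos
  set y := matchingConstant ^ (-(4 / 5) : ℝ) with hy
  have hy0 : 0 < y := Real.rpow_pos_of_pos hC _
  -- `y⁵ = C⁻⁴`
  have hy5 : y ^ 5 = (matchingConstant ^ 4)⁻¹ := by
    rw [hy, ← Real.rpow_natCast, ← Real.rpow_mul hC.le]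
    norm_num [Real.rpow_neg hC.le]
  have hC4l : (2.114 : ℝ) ^ 4 < matchingConstant ^ 4 := pow_lt_pow_left₀ hl (by norm_num) (by norm_num)
  have hC4u : matchingConstant ^ 4 < (2.128 : ℝ) ^ 4 := pow_lt_pow_left₀ hu hC.le (by norm_num)
  have hC4pos : 0 < matchingConstant ^ 4 := by positivity
  constructor
  · -- `0.546 < y ⇔ 0.546⁵ < y⁵ = 1/C⁴ ⇔ C⁴ < 0.546⁻⁵`
    have h5 : (0.546 : ℝ) ^ 5 < y ^ 5 := by
      rw [hy5, lt_inv_comm₀ (by norm_num) hC4pos]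
      calc matchingConstant ^ 4 < (2.128 : ℝ) ^ 4 := hC4u
        _ < ((0.546 : ℝ) ^ 5)⁻¹ := by norm_num
    exact lt_of_pow_lt_pow_left₀ 5 hy0.le h5
  · have h5 : y ^ 5 < (0.550 : ℝ) ^ 5 := by
      rw [hy5, inv_lt_comm₀ hC4pos (by norm_num)]
      calc ((0.550 : ℝ) ^ 5)⁻¹ < (2.114 : ℝ) ^ 4 := by norm_num
        _ < matchingConstant ^ 4 := hC4l
    exact lt_of_pow_lt_pow_left₀ 5 (by norm_num) h5

end Tearing.ResistiveLayer

end Literature.MathematicalPhysics.MHD
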